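import Literature.Analysis.SpecialFunctions.RealGaussianComplexQuadratic
import Literature.Probability.Distributions.BrascampLiebMatrix
import HarnessLib

/-!
# The determinant defect inequality `det(Q − A − B)·det Q ≤ det(Q − A)·det(Q − B)`

Topic `Analysis/Matrix`. For real matrices `Q ≻ 0`, `A, B ⪰ 0` with `Q − A − B ≻ 0`:

  `det(Q − A − B) · det Q ≤ det(Q − A) · det(Q − B)`,

equivalently `det(Q−A−B)/det(Q−A) ≤ det(Q−B)/det Q` — removing a positive semidefinite "defect" from a
Gaussian precision matrix costs (in determinant) at least as much when another defect has already been
removed; at `Q = 1`: `det(1 − A − B) ≤ det(1 − A)·det(1 − B)` (`det_one_sub_sub_le`). Classical proofs go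
through Weyl's monotonicity of eigenvalues; the proof here is elementary: write `A = Σₖ uₖuₖᵀ` (columns of
`√A`), and add the rank-one pieces one at a time, using the matrix determinant lemma
`det(X − uuᵀ) = det X·(1 − uᵀX⁻¹u)` and the monotonicity of the inverse in the form
`X ⪯ Y ⟹ uᵀY⁻¹u ≤ uᵀX⁻¹u`, itself from the identity
`X⁻¹ − Y⁻¹ = Y⁻¹BY⁻¹ + Y⁻¹BX⁻¹BY⁻¹`, `B = Y − X`.

* `inv_sub_inv_eq` — that identity (any commutative ring; recorded for reference — the inequality below
  is taken from the tree's variational `BrascampLiebMatrix.dotProduct_inv_mulVec_antitone`);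
* `dotProduct_inv_mulVec_le` — `uᵀY⁻¹u ≤ uᵀX⁻¹u` for real `0 ≺ X ⪯ Y`;
* `det_sub_vecMulVec` — `det(X − uuᵀ) = det X · (1 − uᵀX⁻¹u)`;
* `det_sub_vecMulVec_mul_det_le` — the rank-one step;
* `det_sub_sub_mul_det_le`, `det_one_sub_sub_le` — the inequality.

All [folklore] (cf. Weyl's monotonicity theorem, [cite: BauerschmidtBrydgesSlade2019Gaussian, Ch. 2] for the
Gaussian-integral reading `E[e^{½ζᵀ(A+B)ζ}] ≥ E[e^{½ζᵀAζ}]·E[e^{½ζᵀBζ}]`-type bookkeeping of regulators).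
Context: merging of large-field regulators in the line `fat-gaussian-defect-calculus` of crux
`BalabanIR.BirComplexStableXYR` (Hubbard summit), companion of `RegulatorRenormalisation.lean` and
`Literature/Probability/Distributions/GaussianQuadraticTilt.lean`.
-/

noncomputable section

open Matrix
open scoped BigOperators MatrixOrder

namespace Literature.Analysis.Matrix

variable {ι : Type*} [Fintype ι] [DecidableEq ι]

/-! ### The inverse-gap identity -/

/-- `X⁻¹ − Y⁻¹ = Y⁻¹(Y − X)X⁻¹` for invertible `X, Y`. [folklore] -/
theorem inv_sub_inv_eq_mul {R : Type*} [CommRing R] {X Y : Matrix ι ι R} (hX : IsUnit X.det)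
    (hY : IsUnit Y.det) : X⁻¹ - Y⁻¹ = Y⁻¹ * (Y - X) * X⁻¹ := by
  rw [Matrix.mul_sub, Matrix.sub_mul, Matrix.nonsing_inv_mul _ hY, Matrix.one_mul, Matrix.mul_assoc,
    Matrix.mul_nonsing_inv _ hX, Matrix.mul_one]

/-- **The inverse-gap identity**: with `B = Y − X`,
`X⁻¹ − Y⁻¹ = Y⁻¹BY⁻¹ + Y⁻¹BX⁻¹BY⁻¹` — a manifestly positive form when `B ⪰ 0`, `X ≻ 0`. [folklore] -/
theorem inv_sub_inv_eq {R : Type*} [CommRing R] {X Y : Matrix ι ι R} (hX : IsUnit X.det)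
    (hY : IsUnit Y.det) :
    X⁻¹ - Y⁻¹ = Y⁻¹ * (Y - X) * Y⁻¹ + Y⁻¹ * (Y - X) * X⁻¹ * (Y - X) * Y⁻¹ := by
  have key : Y⁻¹ + X⁻¹ * (Y - X) * Y⁻¹ = X⁻¹ := by
    rw [Matrix.mul_sub, Matrix.sub_mul, Matrix.nonsing_inv_mul _ hX, Matrix.one_mul, Matrix.mul_assoc,
      Matrix.mul_nonsing_inv _ hY, Matrix.mul_one]
    abel
  calc X⁻¹ - Y⁻¹ = Y⁻¹ * (Y - X) * X⁻¹ := inv_sub_inv_eq_mul hX hY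
    _ = Y⁻¹ * (Y - X) * (Y⁻¹ + X⁻¹ * (Y - X) * Y⁻¹) := by rw [key]
    _ = Y⁻¹ * (Y - X) * Y⁻¹ + Y⁻¹ * (Y - X) * X⁻¹ * (Y - X) * Y⁻¹ := by
      rw [Matrix.mul_add]
      simp only [Matrix.mul_assoc]

/-! ### Monotonicity of the inverse as a quadratic form -/

/-- **Monotonicity of the inverse**: for real `X ≻ 0` and `Y = X + B` with `B ⪰ 0`,
`uᵀY⁻¹u ≤ uᵀX⁻¹u` for every `u` (the tree's variational `dotProduct_inv_mulVec_antitone` of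
`BrascampLiebMatrix`, in the form used below; `inv_sub_inv_eq` is the algebraic identity behind it).
[folklore] -/
theorem dotProduct_inv_mulVec_le {X Y : Matrix ι ι ℝ} (hX : X.PosDef) (hYX : (Y - X).PosSemidef)
    (u : ι → ℝ) : u ⬝ᵥ Y⁻¹ *ᵥ u ≤ u ⬝ᵥ X⁻¹ *ᵥ u := by
  have hY : Y.PosDef := by
    have := hX.add_posSemidef hYX
    rwa [add_sub_cancel] at this
  refine Literature.Probability.Distributions.BrascampLiebMatrix.dotProduct_inv_mulVec_antitone hX hY
    (fun v => ?_) u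
  have h := hYX.dotProduct_mulVec_nonneg v
  rw [star_trivial, Matrix.sub_mulVec, dotProduct_sub] at h
  linarith

/-! ### The rank-one determinant formula -/

/-- **Matrix determinant lemma, rank-one removal**: `det(X − uuᵀ) = det X · (1 − uᵀX⁻¹u)` for
invertible `X`. [folklore] -/
theorem det_sub_vecMulVec {R : Type*} [CommRing R] {X : Matrix ι ι R} (hX : IsUnit X.det) (u : ι → R) :
    (X - vecMulVec u u).det = X.det * (1 - u ⬝ᵥ X⁻¹ *ᵥ u) := by
  have hXu : X *ᵥ (-(X⁻¹ *ᵥ u)) = -u := by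
    rw [Matrix.mulVec_neg, Matrix.mulVec_mulVec, Matrix.mul_nonsing_inv _ hX, Matrix.one_mulVec]
  have hfac : X - vecMulVec u u =
      X * (1 + replicateCol Unit (-(X⁻¹ *ᵥ u)) * replicateRow Unit u) := by
    rw [Matrix.mul_add, Matrix.mul_one, ← Matrix.mul_assoc, ← Matrix.replicateCol_mulVec, hXu,
      sub_eq_add_neg, Matrix.vecMulVec_eq Unit]
    congr 1
    ext i j
    simp [Matrix.mul_apply]
  rw [hfac, Matrix.det_mul, Matrix.det_one_add_replicateCol_mul_replicateRow, dotProduct_neg,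
    ← sub_eq_add_neg]

/-! ### The rank-one step and the inequality -/

/-- **Rank-one step**: for real `0 ≺ X ⪯ Y` and any vector `u`,
`det(X − uuᵀ)·det Y ≤ det X·det(Y − uuᵀ)`. [folklore] -/
theorem det_sub_vecMulVec_mul_det_le {X Y : Matrix ι ι ℝ} (hX : X.PosDef) (hYX : (Y - X).PosSemidef)
    (u : ι → ℝ) : (X - vecMulVec u u).det * Y.det ≤ X.det * (Y - vecMulVec u u).det := by
  have hY : Y.PosDef := by
    have := hX.add_posSemidef hYX
    rwa [add_sub_cancel] at this
  have hXu : IsUnit X.det := (Matrix.isUnit_iff_isUnit_det _).1 hX.isUnit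
  have hYu : IsUnit Y.det := (Matrix.isUnit_iff_isUnit_det _).1 hY.isUnit
  rw [det_sub_vecMulVec hXu, det_sub_vecMulVec hYu]
  have hle := dotProduct_inv_mulVec_le hX hYX u
  have hpos : 0 < X.det * Y.det := mul_pos hX.det_pos hY.det_pos
  nlinarith

/-- The columns of `√A` decompose a real positive semidefinite `A` into rank-one pieces:
`A = Σₖ uₖuₖᵀ`, `uₖ = (√A)·ₖ`. [folklore] -/
theorem eq_sum_vecMulVec_sqrt_col {A : Matrix ι ι ℝ} (hA : A.PosSemidef) :
    A = ∑ k, vecMulVec (fun i => CFC.sqrt A i k) (fun i => CFC.sqrt A i k) := by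
  have hT : (CFC.sqrt A)ᵀ = CFC.sqrt A := by
    have h : (CFC.sqrt A)ᴴ = CFC.sqrt A := (CFC.sqrt_nonneg A).isSelfAdjoint
    rwa [Matrix.conjTranspose_eq_transpose_of_trivial] at h
  have hTT : CFC.sqrt A * CFC.sqrt A = A := CFC.sqrt_mul_sqrt_self A hA.nonneg
  conv_lhs => rw [← hTT]
  nth_rewrite 2 [← hT]
  ext i j
  simp [Matrix.mul_apply, Matrix.sum_apply, vecMulVec_apply]

omit [DecidableEq ι] in
/-- A partial sum of the rank-one pieces is dominated by the full sum: `Σ_{k∈s} uₖuₖᵀ ⪯ Σₖ uₖuₖᵀ`.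
[folklore] -/
theorem posSemidef_sum_sub_sum_vecMulVec (u : ι → ι → ℝ) (s : Finset ι) :
    (∑ k, vecMulVec (u k) (u k) - ∑ k ∈ s, vecMulVec (u k) (u k)).PosSemidef := by
  classical
  rw [← Finset.sum_sdiff (Finset.subset_univ s), add_sub_cancel_right]
  refine posSemidef_sum _ fun k _ => ?_
  have h := posSemidef_vecMulVec_self_star (u k)
  rwa [star_trivial] at h

/-- **The determinant defect inequality.** For real matrices `Q ≻ 0`, `A ⪰ 0`, `B ⪰ 0` with
`Q − A − B ≻ 0`: `det(Q − A − B) · det Q ≤ det(Q − A) · det(Q − B)`. [folklore] -/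
theorem det_sub_sub_mul_det_le {Q A B : Matrix ι ι ℝ} (hQ : Q.PosDef) (hA : A.PosSemidef)
    (hB : B.PosSemidef) (h : (Q - A - B).PosDef) :
    (Q - A - B).det * Q.det ≤ (Q - A).det * (Q - B).det := by
  classical
  -- rank-one decomposition of `A`
  set u : ι → ι → ℝ := fun k i => CFC.sqrt A i k with hu
  have hAsum : A = ∑ k, vecMulVec (u k) (u k) := eq_sum_vecMulVec_sqrt_col hA
  -- the statement along the partial sums `A_s`
  suffices key : ∀ s : Finset ι,
      (Q - (∑ k ∈ s, vecMulVec (u k) (u k)) - B).det * Q.det ≤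
        (Q - ∑ k ∈ s, vecMulVec (u k) (u k)).det * (Q - B).det by
    have := key Finset.univ
    rwa [← hAsum] at this
  intro s
  -- positivity along the way: `Q − A_s − B ≻ 0` and `Q − A_s ≻ 0`
  have hXs : ∀ s : Finset ι, (Q - (∑ k ∈ s, vecMulVec (u k) (u k)) - B).PosDef := fun s => by
    have h1 := h.add_posSemidef (posSemidef_sum_sub_sum_vecMulVec u s)
    rw [← hAsum] at h1
    convert h1 using 1
    abel
  have hYs : ∀ s : Finset ι, (Q - ∑ k ∈ s, vecMulVec (u k) (u k)).PosDef := fun s => by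
    have h1 := (hXs s).add_posSemidef hB
    rwa [sub_add_cancel] at h1
  induction s using Finset.induction_on with
  | empty =>
    simp only [Finset.sum_empty, sub_zero]
    rw [mul_comm]
  | insert k s hk ih =>
    rw [Finset.sum_insert hk]
    set As := ∑ k ∈ s, vecMulVec (u k) (u k) with hAs
    have hX := hXs s
    have hY := hYs s
    have hY' := hYs (insert k s)
    rw [Finset.sum_insert hk] at hY'
    -- the rank-one step with `X = Q − A_s − B`, `Y = Q − A_s`
    have hYX : ((Q - As) - (Q - As - B)).PosSemidef := by
      convert hB using 1
      abel
    have step := det_sub_vecMulVec_mul_det_le hX hYX (u k)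
    have e1 : Q - As - B - vecMulVec (u k) (u k) = Q - (vecMulVec (u k) (u k) + As) - B := by abel
    have e2 : Q - As - vecMulVec (u k) (u k) = Q - (vecMulVec (u k) (u k) + As) := by abel
    rw [e1, e2] at step
    -- chain: `det X'·det Q·det Y ≤ det X·det Y'·det Q ≤ det Y·det(Q−B)·det Y'`, cancel `det Y > 0`
    have hYpos : 0 < (Q - As).det := hY.det_pos
    have hY'pos : 0 < (Q - (vecMulVec (u k) (u k) + As)).det := hY'.det_pos
    have hQpos : 0 < Q.det := hQ.det_pos
    nlinarith [mul_le_mul_of_nonneg_right step hQpos.le, mul_le_mul_of_nonneg_right ih hY'pos.le]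

/-- **Weyl form**: for real `A, B ⪰ 0` with `1 − A − B ≻ 0`, `det(1 − A − B) ≤ det(1 − A)·det(1 − B)`.
[folklore] -/
theorem det_one_sub_sub_le {A B : Matrix ι ι ℝ} (hA : A.PosSemidef) (hB : B.PosSemidef)
    (h : (1 - A - B).PosDef) : (1 - A - B).det ≤ (1 - A).det * (1 - B).det := by
  have := det_sub_sub_mul_det_le Matrix.PosDef.one hA hB h
  rwa [Matrix.det_one, mul_one] at this

/-- **Ratio form**: `det(Q − A − B)/det(Q − A) ≤ det(Q − B)/det Q`. [folklore] -/
theorem det_sub_sub_div_le {Q A B : Matrix ι ι ℝ} (hQ : Q.PosDef) (hA : A.PosSemidef)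
    (hB : B.PosSemidef) (h : (Q - A - B).PosDef) :
    (Q - A - B).det / (Q - A).det ≤ (Q - B).det / Q.det := by
  have hQA : (Q - A).PosDef := by
    have := h.add_posSemidef hB
    rwa [sub_add_cancel] at this
  rw [div_le_div_iff₀ hQA.det_pos hQ.det_pos, mul_comm ((Q - B).det)]
  exact det_sub_sub_mul_det_le hQ hA hB h

end Literature.Analysis.Matrix
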